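import Mathlib.RingTheory.Jacobson.Ring
import Mathlib.Algebra.MvPolynomial.Equiv
import Mathlib.RingTheory.PrincipalIdealDomain
import HarnessLib

/-!
# Maximal ideals of `F[X₁, …, Xₙ]` are generated by `n` elements
# (stmt-ResolutionOfSingularities-16088, line `birth`, branch DiscreteRange, S3a
# `stub_dr_mvPolynomial_maximal_span`)

Let `F` be any field and `n : ℕ`. Every maximal ideal `m` of the polynomial ring
`MvPolynomial (Fin n) F = F[X₁, …, Xₙ]` is generated by `n` elements. In the branch this is the
generator count behind the regularity of the blown-up centres (embedding dimension `≤ n + 1`).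

Proof (classical, no Nullstellensatz, `F` arbitrary). Induction on `n`. For `n = 0` the ring is
the field `F` and `m = ⊥ = span ∅`. For the step write
`F[X₀, …, Xₙ] ≅ A[X]` with `A := F[X₁, …, Xₙ]` (`MvPolynomial.finSuccEquiv`) and let `M ⊆ A[X]` be
maximal. Since `A` is a Jacobson ring, the contraction `m₀ := M ∩ A` is maximal
(`Polynomial.isMaximal_comap_C_of_isJacobsonRing`), so by induction `m₀ = (g₁, …, gₙ)`. The image
of `M` in `(A ⧸ m₀)[X]`, a principal ideal domain, is generated by the image of one `h ∈ M`, and the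
kernel of `A[X] → (A ⧸ m₀)[X]` is `m₀ A[X]`; hence `M = (h, g₁, …, gₙ)`, i.e. `n + 1` generators.

References: H. Matsumura, *Commutative Ring Theory* (CUP 1986), Theorem 5.3 ("Hence `m` can be
generated by `n` elements"); E. Kunz, *Introduction to Commutative Algebra and Algebraic Geometry*
(Birkhäuser 1985), Ch. I §3, Exercise 1 (a), (b) — the relative form (b) is
`exists_eq_span_range_cons` below. Folklore.
-/

noncomputable section

-- single-problem summit: the doubled namespace component `ResolutionOfSingularities` is forced
set_option linter.dupNamespace false

open Polynomial

namespace Summit.ResolutionOfSingularities.ResolutionOfSingularities.Theorems.IndSmoothBirth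

/-! ## The polynomial step -/

/-- Let `A` be a commutative ring and `M ⊆ A[X]` an ideal whose contraction `m₀ := M ∩ A` is a
maximal ideal of `A`. Then `M = (h) + m₀ A[X]` for a single `h ∈ A[X]`: the image of `M` in the
principal ideal domain `(A ⧸ m₀)[X]` is principal, generated by the image of some `h ∈ M`, and the
kernel of the reduction map `A[X] → (A ⧸ m₀)[X]` is `m₀ A[X]`. [folklore] -/
theorem exists_eq_span_singleton_sup_map_C {A : Type*} [CommRing A] (M : Ideal A[X])
    (hM : (M.comap (C : A →+* A[X])).IsMaximal) :
    ∃ h : A[X], h ∈ M ∧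
      M = Ideal.span {h} ⊔ (M.comap (C : A →+* A[X])).map (C : A →+* A[X]) := by
  set m₀ : Ideal A := M.comap (C : A →+* A[X]) with hm₀
  letI : Field (A ⧸ m₀) := Ideal.Quotient.field m₀
  let π : A[X] →+* (A ⧸ m₀)[X] := mapRingHom (Ideal.Quotient.mk m₀)
  have hπ : Function.Surjective π :=
    Polynomial.map_surjective (Ideal.Quotient.mk m₀) Ideal.Quotient.mk_surjective
  have hker : RingHom.ker π = m₀.map C := by
    rw [Polynomial.ker_mapRingHom, Ideal.mk_ker]
  obtain ⟨gbar, hgbar⟩ := (IsPrincipalIdealRing.principal (M.map π)).principal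
  have hgmem : gbar ∈ M.map π := by
    rw [hgbar]
    exact Submodule.mem_span_singleton_self gbar
  obtain ⟨h, hhM, rfl⟩ := (Ideal.mem_map_iff_of_surjective π hπ).mp hgmem
  refine ⟨h, hhM, le_antisymm ?_ (sup_le ?_ (Ideal.map_le_iff_le_comap.mpr le_rfl))⟩
  · calc M ≤ (M.map π).comap π := Ideal.le_comap_map
      _ = (Ideal.map π (Ideal.span {h})).comap π := by
          rw [Ideal.map_span, Set.image_singleton, hgbar, Ideal.submodule_span_eq]
      _ = Ideal.span {h} ⊔ Ideal.comap π ⊥ := Ideal.comap_map_of_surjective π hπ _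
      _ = Ideal.span {h} ⊔ m₀.map C := by rw [← RingHom.ker_eq_comap_bot, hker]
  · rw [Ideal.span_le, Set.singleton_subset_iff]
    exact hhM

/-- If moreover the contraction `M ∩ A = (g₁, …, gₙ)` is generated by `n` elements, then
`M = (h, g₁, …, gₙ)` is generated by `n + 1` elements. [folklore] -/
theorem exists_eq_span_range_cons {A : Type*} [CommRing A] {n : ℕ} (M : Ideal A[X])
    (hM : (M.comap (C : A →+* A[X])).IsMaximal) (g : Fin n → A)
    (hg : M.comap (C : A →+* A[X]) = Ideal.span (Set.range g)) :
    ∃ h : A[X],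
      M = Ideal.span (Set.range (Fin.cons h (fun i => C (g i)) : Fin (n + 1) → A[X])) := by
  obtain ⟨h, -, hh⟩ := exists_eq_span_singleton_sup_map_C M hM
  refine ⟨h, ?_⟩
  rw [hh, hg, Ideal.map_span, ← Set.range_comp, Fin.range_cons, Set.insert_eq, Ideal.span_union]
  rfl

/-! ## Maximal ideals of `F[X₁, …, Xₙ]` -/

/-- **Maximal ideals of a polynomial ring in `n` variables over a field are `n`-generated.**
For any field `F`, every maximal ideal `m` of `MvPolynomial (Fin n) F` is of the form
`m = (g₁, …, gₙ)` for some family `g : Fin n → MvPolynomial (Fin n) F`. Induction on `n` via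
`MvPolynomial.finSuccEquiv`, the Jacobson property of polynomial rings over a field
(`Polynomial.isMaximal_comap_C_of_isJacobsonRing`) and the fact that `κ[X]` is a principal ideal
domain for a field `κ`. [folklore] -/
theorem stub_dr_mvPolynomial_maximal_span (F : Type) [Field F] (n : ℕ)
    (m : Ideal (MvPolynomial (Fin n) F)) (hm : m.IsMaximal) :
    ∃ g : Fin n → MvPolynomial (Fin n) F, m = Ideal.span (Set.range g) := by
  induction n with
  | zero =>
    refine ⟨fun i => i.elim0, ?_⟩
    let e : MvPolynomial (Fin 0) F ≃+* F := MvPolynomial.isEmptyRingEquiv F (Fin 0)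
    haveI : (m.map (e : MvPolynomial (Fin 0) F →+* F)).IsMaximal := Ideal.map_isMaximal_of_equiv e
    have hbot : m.map (e : MvPolynomial (Fin 0) F →+* F) = ⊥ := Ideal.eq_bot_of_prime _
    rw [Set.range_eq_empty, Ideal.span_empty, ← Ideal.map_of_equiv (I := m) e, hbot, Ideal.map_bot]
  | succ n ih =>
    let e : MvPolynomial (Fin (n + 1)) F ≃+* (MvPolynomial (Fin n) F)[X] :=
      (MvPolynomial.finSuccEquiv F n).toRingEquiv
    set M : Ideal (MvPolynomial (Fin n) F)[X] :=
      m.map (e : MvPolynomial (Fin (n + 1)) F →+* (MvPolynomial (Fin n) F)[X]) with hMdef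
    haveI hMmax : M.IsMaximal := Ideal.map_isMaximal_of_equiv e
    have hM₀ : (M.comap (C : MvPolynomial (Fin n) F →+* (MvPolynomial (Fin n) F)[X])).IsMaximal :=
      Polynomial.isMaximal_comap_C_of_isJacobsonRing M
    obtain ⟨g, hg⟩ := ih (M.comap C) hM₀
    obtain ⟨h, hh⟩ := exists_eq_span_range_cons M hM₀ g hg
    refine ⟨fun i => e.symm ((Fin.cons h (fun i => C (g i)) : Fin (n + 1) → _) i), ?_⟩
    calc m = M.map (e.symm : (MvPolynomial (Fin n) F)[X] →+* MvPolynomial (Fin (n + 1)) F) :=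
          (Ideal.map_of_equiv (I := m) e).symm
      _ = _ := by
          rw [hh, Ideal.map_span, ← Set.range_comp]
          rfl

end Summit.ResolutionOfSingularities.ResolutionOfSingularities.Theorems.IndSmoothBirth

end
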